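import Literature.Analysis.FluidPDE.SereginSverak2002VertexBlowupLimit
import HarnessLib

/-!
# Route `TerminalTrace`, support `MorreyCellCriterion` (stmt-NavierStokesRegularity-18615 = `stub_morrey_cell` of line `birth`
# of crux 18614): STEP 1 of its filed road — the blow-up limit at the vertex from the VERTEX bound on the scaled energy `A`

Seat nsreg-C26-p1 g6 (cell ns-regularity-ideate), `--supports stmt-NavierStokesRegularity-18615 --as helper` (the provable part of
the stub, taken per DIRECTOR-NS #253 (2); closes nothing).  The route docstring of 18615 files the road «`exists_blowup_limit_at_vertex`
with the Morrey bound replacing `hone` as the source of compactness».  In the tree's `SereginSverak2002.exists_blowup_limit_at_vertex`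
the one-sided pressure bound `hone` is used ONLY through `cknAEss_le_uniform` (a bound on `A_ess(r; (T, x₀))`, `r ≤ ρ`), which
Seregin's theorem (`Seregin2020.scaledEnergies_bounded_of_cknAEss_le`) turns into bounds on `C, D` at the vertex; so the item's
hypothesis `∃ M r₀, ∀ r ∈ (0, r₀), cknA r (T, x₀) u ≤ M` (with `cknAEss ≤ cknA`) runs the same proof:

* `TraceDensityCriterion.exists_vertex_cknC_cknD_le_of_cknA` — Type I for `C` and `D` (gauged pressure) at the vertex;
* `TraceDensityCriterion.exists_blowup_limit_at_vertex_of_cknA` — the blow-up limit `(w, π)` at `(T, x₀)` along scales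
  `R_j → 0⁺`: suitable in every `Q(a)`, `w ∈ L³(Q(a))`, strong `L³` convergence of the zooms, weak convergence of the zoomed
  gauged pressures.

The remaining steps of the road are audited in the evidence note `MORREY-CELL-ROAD-AUDIT.md` on the item (step 3 «largeness on
final windows without `hone`» is open; step 4 needs an all-centre Morrey bound).  WHAT THIS IS NOT: not NS regularity, not 18615.
[cite: SereginSverak2002, §4] [cite: Seregin2007CriticalMorreyEstimates, Thm. 1.2] [cite: Seregin2014, §6.6 Prop. 6.20]
-/

noncomputable section

set_option linter.dupNamespace false

open _root_.MeasureTheory Set Function Filter _root_.Topology TopologicalSpace Metric Real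
open scoped NNReal ENNReal RealInnerProductSpace ContDiff

namespace Summit.NavierStokesRegularity.NavierStokesRegularity.Theorems.TraceDensityCriterion

open Literature.Analysis.FluidPDE Literature.Analysis.FluidPDE.SereginSverak2002

variable {T : ℝ} {u : ℝ → EuclideanSpace ℝ (Fin 3) → EuclideanSpace ℝ (Fin 3)}
  {p : ℝ → EuclideanSpace ℝ (Fin 3) → ℝ}

/-- **Type I for `C` and `D` at a vertex of the final slice, from a VERTEX bound on `A`** (the Morrey cell of
`TerminalTrace.MorreyCellCriterion`, stmt-NavierStokesRegularity-18615): if `cknA r (T, x₀) u ≤ M` for `0 < r < r₀`, then for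
`0 < ρ` with `ρ² < T`, `ρ < r₀` there is `K₀` with `C(r; (T, x₀)) ≤ K₀` and `D(r; (T, x₀)) ≤ K₀` (gauged pressure) for
all `0 < r ≤ ρ/2` (Seregin's theorem: a bound on `A` at the vertex bounds `C, D, E` there; the tree's
`Seregin2020.scaledEnergies_bounded_of_cknAEss_le`).  The proof of `SereginSverak2002.exists_vertex_cknC_cknD_le` with the
one-sided pressure bound `hone` replaced by the vertex `A`-bound. [cite: Seregin2007CriticalMorreyEstimates, Thm. 1.2]
[cite: SereginSverak2002, §3] -/
theorem exists_vertex_cknC_cknD_le_of_cknA (hT : 0 < T)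
    (hsol : IsClassicalNSSolutionOn (Ico 0 T) 1 0 u p) (hLH : IsLerayHopfOn T 1 0 (u 0) u)
    (x₀ : EuclideanSpace ℝ (Fin 3)) {M : ℝ≥0} {r₀ : ℝ}
    (hA : ∀ r : ℝ, 0 < r → r < r₀ → cknA r (T, x₀) u ≤ M)
    {ρ : ℝ} (hρ : 0 < ρ) (hρT : ρ ^ 2 < T) (hρr₀ : ρ < r₀) :
    ∃ K₀ : ℝ≥0, ∀ r ∈ Ioc 0 (ρ / 2),
      cknC r (T, x₀) u ≤ K₀ ∧
      cknD r (T, x₀) (fun t x => p t x - (p t 0 - normalisedPressure (u t) 0)) ≤ K₀ := by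
  -- adapted from Literature/Analysis/FluidPDE/SereginSverak2002VertexBlowupLimit.lean (`exists_vertex_cknC_cknD_le`)
  set z₀ : ℝ × EuclideanSpace ℝ (Fin 3) := (T, x₀) with hz₀
  set Q : Opens (ℝ × EuclideanSpace ℝ (Fin 3)) := parabolicCylinderOpens ρ z₀ with hQdef
  have hQ : (Q : Set (ℝ × EuclideanSpace ℝ (Fin 3))) = parabolicCylinder ρ z₀ := rfl
  have hQslab : (Q : Set (ℝ × EuclideanSpace ℝ (Fin 3))) ⊆
      Ioo 0 T ×ˢ (univ : Set (EuclideanSpace ℝ (Fin 3))) := by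
    rw [hQ]; exact parabolicCylinder_vertex_subset_slab hρT.le x₀
  set q : ℝ → EuclideanSpace ℝ (Fin 3) → ℝ :=
    fun t x => p t x - (p t 0 - normalisedPressure (u t) 0) with hq
  have hsws : IsSuitableWeakSolutionOn Q 1 0 u q :=
    isSuitableWeakSolutionOn_gauge_of_classical one_pos hT hsol hLH Q hQslab
  obtain ⟨G, hGslab, -, hGint, -⟩ := hLH.exists_hasWeakSpatialGradientOn
  have hle : Q ≤ slab (EuclideanSpace ℝ (Fin 3)) (Ioo 0 T) isOpen_Ioo := by
    intro z hz
    change z ∈ Ioo 0 T ×ˢ (univ : Set (EuclideanSpace ℝ (Fin 3)))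
    exact hQslab hz
  have hG : HasWeakSpatialGradientOn Q u G := hGslab.mono hle
  have hρ0 : ENNReal.ofReal ρ ≠ 0 := by rwa [ne_eq, ENNReal.ofReal_eq_zero, not_le]
  have hE₀ : cknE ρ z₀ G ≠ ⊤ := by
    refine ENNReal.mul_ne_top (ENNReal.inv_ne_top.2 hρ0) (ne_top_of_le_ne_top hGint.ne ?_)
    exact lintegral_mono_set (by rw [← hQ]; exact hQslab)
  have hD₀ : cknD ρ z₀ q ≠ ⊤ := by
    refine ENNReal.mul_ne_top (ENNReal.inv_ne_top.2 (pow_ne_zero 2 hρ0))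
      (ne_top_of_le_ne_top (lintegral_slab_gauged_pressure_lt_top one_pos hT hsol hLH).ne ?_)
    exact lintegral_mono_set (by rw [← hQ]; exact hQslab)
  have hMA : ∀ r ∈ Ioc (0 : ℝ) ρ, cknAEss r z₀ u ≤ M := fun r hr =>
    cknAEss_le_cknA.trans (hA r hr.1 (lt_of_le_of_lt hr.2 hρr₀))
  obtain ⟨K₀, hK₀⟩ := Seregin2020.scaledEnergies_bounded_of_cknAEss_le hsws hG hρ
    (by rw [hQ]) hE₀ hD₀ hMA
  refine ⟨K₀, fun r hr => ⟨?_, ?_⟩⟩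
  · exact le_trans (by
      calc cknC r z₀ u ≤ cknAEss r z₀ u + cknE r z₀ G + cknC r z₀ u + cknD r z₀ q :=
            le_add_right le_add_self) (hK₀ r hr)
  · exact le_trans le_add_self (hK₀ r hr)

/-! ### The blow-up limit at the vertex -/

/-- **The blow-up limit of the gauged pair at the vertex `(T, x₀)`, from a VERTEX bound on `A`** (Morrey cell of
`TerminalTrace.MorreyCellCriterion`, stmt-NavierStokesRegularity-18615 — step 1 of its filed road): for a classical
Leray–Hopf solution on `[0, T)` (`ν = 1`) with `cknA r (T, x₀) u ≤ M` for `0 < r < r₀` there are scales `R_j → 0⁺` and a pair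
`(w, π)` such that for every `a > 0`: `(w, π)` is a suitable weak solution in `Q(a)`, `w ∈ L³(Q(a))`,
`R_j u(T + R_j² ·, x₀ + R_j ·) → w` in `L³(Q(a))`, and the zoomed gauged pressures converge weakly against `L³(Q(a))`.
The proof of `SereginSverak2002.exists_blowup_limit_at_vertex` with `hone` replaced by the vertex `A`-bound (pre-zoom scale
`ρ₀ < r₀`). [cite: SereginSverak2002, §4; Seregin2014 Prop. 6.20] [cite: Seregin2007CriticalMorreyEstimates, Thm. 1.2] -/
theorem exists_blowup_limit_at_vertex_of_cknA (hT : 0 < T)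
    (hsol : IsClassicalNSSolutionOn (Ico 0 T) 1 0 u p) (hLH : IsLerayHopfOn T 1 0 (u 0) u)
    (x₀ : EuclideanSpace ℝ (Fin 3)) {M : ℝ≥0} {r₀ : ℝ} (hr₀ : 0 < r₀)
    (hA : ∀ r : ℝ, 0 < r → r < r₀ → cknA r (T, x₀) u ≤ M) :
    ∃ (R : ℕ → ℝ) (w : ℝ → EuclideanSpace ℝ (Fin 3) → EuclideanSpace ℝ (Fin 3))
      (pL : ℝ → EuclideanSpace ℝ (Fin 3) → ℝ),
      (∀ j, 0 < R j) ∧ (∀ j, R j ^ 2 ≤ T) ∧ Tendsto R atTop (𝓝 0) ∧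
      ∀ a : ℝ, 0 < a →
        IsSuitableWeakSolutionInBall a 0 w pL ∧
        MemLp (uncurry w) 3
          (volume.restrict (parabolicCylinder a (0 : ℝ × EuclideanSpace ℝ (Fin 3)))) ∧
        Tendsto (fun j => eLpNorm
            (uncurry ((R j) • stPull ((R j) ^ 2) (R j) T x₀ u) - uncurry w) 3
            (volume.restrict (parabolicCylinder a (0 : ℝ × EuclideanSpace ℝ (Fin 3)))))
          atTop (𝓝 0) ∧
        ∀ g : ℝ × EuclideanSpace ℝ (Fin 3) → ℝ,
          MemLp g 3 (volume.restrict (parabolicCylinder a (0 : ℝ × EuclideanSpace ℝ (Fin 3)))) →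
          Tendsto (fun j => ∫ w' in parabolicCylinder a (0 : ℝ × EuclideanSpace ℝ (Fin 3)),
              ((R j) ^ 2 • stPull ((R j) ^ 2) (R j) T x₀
                  (fun t x => p t x - (p t 0 - normalisedPressure (u t) 0))) w'.1 w'.2 * g w')
            atTop (𝓝 (∫ w' in parabolicCylinder a (0 : ℝ × EuclideanSpace ℝ (Fin 3)),
              pL w'.1 w'.2 * g w')) := by
  -- adapted from Literature/Analysis/FluidPDE/SereginSverak2002VertexBlowupLimit.lean (`exists_blowup_limit_at_vertex`)
  -- the pre-zoom scale `ρ₀ < r₀`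
  obtain ⟨ρ₀, hρ₀pos, hρ₀half, hρ₀sqT, hρ₀r₀⟩ :
      ∃ ρ₀ : ℝ, 0 < ρ₀ ∧ ρ₀ ≤ 1 / 2 ∧ ρ₀ ^ 2 ≤ T / 4 ∧ ρ₀ < r₀ := by
    refine ⟨min (min (1 / 2) (Real.sqrt T / 2)) (r₀ / 2), lt_min (lt_min (by norm_num) (by positivity)) (by positivity),
      (min_le_left _ _).trans (min_le_left _ _), ?_, lt_of_le_of_lt (min_le_right _ _) (by linarith)⟩
    have h0 : 0 ≤ min (min (1 / 2) (Real.sqrt T / 2)) (r₀ / 2) :=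
      le_min (le_min (by norm_num) (by positivity)) (by positivity)
    have h2 := pow_le_pow_left₀ h0 ((min_le_left _ _).trans (min_le_right (1 / 2) (Real.sqrt T / 2))) 2
    rw [div_pow, Real.sq_sqrt hT.le] at h2
    linarith
  have hρ₀T : ρ₀ ^ 2 < T := by linarith
  obtain ⟨K₀, hK₀⟩ := exists_vertex_cknC_cknD_le_of_cknA hT hsol hLH x₀ hA hρ₀pos hρ₀T hρ₀r₀
  set q : ℝ → EuclideanSpace ℝ (Fin 3) → ℝ :=
    fun t x => p t x - (p t 0 - normalisedPressure (u t) 0) with hq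
  -- the pre-zoomed pair at scale `ρ₀`
  set v : ℝ → EuclideanSpace ℝ (Fin 3) → EuclideanSpace ℝ (Fin 3) :=
    ρ₀ • stPull (ρ₀ ^ 2) ρ₀ T x₀ u with hv
  set pv : ℝ → EuclideanSpace ℝ (Fin 3) → ℝ := ρ₀ ^ 2 • stPull (ρ₀ ^ 2) ρ₀ T x₀ q with hpv
  -- composition of parabolic zooms (`zoom_zoom`, `ESSLocalHolderBlowupLimit.lean`)
  have hzoomv : ∀ c : ℝ, c • stPull (c ^ 2) c 0 0 v =
      (c * ρ₀) • stPull ((c * ρ₀) ^ 2) (c * ρ₀) T x₀ u := fun c => by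
    rw [hv, zoom_zoom]
  have hzoomp : ∀ c : ℝ, c ^ 2 • stPull (c ^ 2) c 0 0 pv =
      (c * ρ₀) ^ 2 • stPull ((c * ρ₀) ^ 2) (c * ρ₀) T x₀ q := fun c => by
    rw [hpv, zoom_zoom, mul_pow]
  -- measurability of `v` on `Q(1/2)`: continuity
  have hvm : AEStronglyMeasurable (uncurry v)
      (volume.restrict (parabolicCylinder (1 / 2) ((0 : ℝ), (0 : EuclideanSpace ℝ (Fin 3))))) := by
    have hmaps : MapsTo (fun z : ℝ × EuclideanSpace ℝ (Fin 3) => (T + ρ₀ ^ 2 * z.1, x₀ + ρ₀ • z.2))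
        (parabolicCylinder (1 / 2) ((0 : ℝ), (0 : EuclideanSpace ℝ (Fin 3))))
        (Ico 0 T ×ˢ (univ : Set (EuclideanSpace ℝ (Fin 3)))) := by
      intro z hz
      rw [parabolicCylinder] at hz
      obtain ⟨⟨hz1, hz2⟩, -⟩ := hz
      simp only at hz1 hz2
      refine ⟨⟨?_, ?_⟩, mem_univ _⟩
      · show 0 ≤ T + ρ₀ ^ 2 * z.1
        nlinarith [hρ₀sqT, hz1]
      · show T + ρ₀ ^ 2 * z.1 < T
        nlinarith [mul_neg_of_pos_of_neg (pow_pos hρ₀pos 2) hz2]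
    have hcont : ContinuousOn (uncurry v)
        (parabolicCylinder (1 / 2) ((0 : ℝ), (0 : EuclideanSpace ℝ (Fin 3)))) := by
      have hu := hsol.smooth_velocity.continuousOn
      have haff : Continuous fun z : ℝ × EuclideanSpace ℝ (Fin 3) =>
          (T + ρ₀ ^ 2 * z.1, x₀ + ρ₀ • z.2) := by fun_prop
      have := (hu.comp haff.continuousOn hmaps).const_smul ρ₀
      exact this.congr fun z _ => rfl
    exact hcont.aestronglyMeasurable (isOpen_parabolicCylinder _ _).measurableSet
  -- suitability of all zooms of `v`
  have hsuit : ∀ c ∈ Ioc (0 : ℝ) (1 / 2), IsSuitableWeakSolutionInBall 1 0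
      (c • stPull (c ^ 2) c 0 0 v) (c ^ 2 • stPull (c ^ 2) c 0 0 pv) := by
    intro c hc
    have hcc : 0 < c * ρ₀ := mul_pos hc.1 hρ₀pos
    have hccT : (c * ρ₀) ^ 2 ≤ T := by
      have hc1 : c ^ 2 ≤ 1 := by nlinarith [hc.1, hc.2]
      have : (c * ρ₀) ^ 2 ≤ ρ₀ ^ 2 := by
        rw [mul_pow]; exact mul_le_of_le_one_left (sq_nonneg _) hc1
      linarith
    have h := (isSuitableWeakSolutionInBall_vertex hT hsol hLH x₀ hccT).zoom hcc
    rw [hzoomv, hzoomp]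
    exact h
  -- Type I for `C`, `D` of `v` at the origin
  have hM : ∀ r ∈ Ioc (0 : ℝ) (1 / 2), cknC r ((0 : ℝ), (0 : EuclideanSpace ℝ (Fin 3))) v ≤ K₀ := by
    intro r hr
    rw [hv, cknC_zoom hρ₀pos hr.1 (T, x₀) u]
    exact (hK₀ (r * ρ₀) ⟨mul_pos hr.1 hρ₀pos, by nlinarith [hr.2, hρ₀pos]⟩).1
  have hD : ∀ r ∈ Ioc (0 : ℝ) (1 / 2), cknD r ((0 : ℝ), (0 : EuclideanSpace ℝ (Fin 3))) pv ≤ K₀ := by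
    intro r hr
    rw [hpv, cknD_zoom hρ₀pos hr.1 (T, x₀) q]
    exact (hK₀ (r * ρ₀) ⟨mul_pos hr.1 hρ₀pos, by nlinarith [hr.2, hρ₀pos]⟩).2
  -- the tree's blow-up limit
  obtain ⟨δ, w, pL, hδ, -, hlim⟩ := exists_zoom_blowup_limit hvm hsuit hM hD
  -- the scales `R_j = 2^{-(δ j + 2)} ρ₀`
  refine ⟨fun j => (1 / 2 : ℝ) ^ (δ j + 2) * ρ₀, w, pL, fun j => by positivity, fun j => ?_, ?_, ?_⟩
  · have h1 : ((1 / 2 : ℝ) ^ (δ j + 2) * ρ₀) ^ 2 ≤ ρ₀ ^ 2 := by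
      have : (1 / 2 : ℝ) ^ (δ j + 2) ≤ 1 := pow_le_one₀ (by norm_num) (by norm_num)
      rw [mul_pow]
      exact mul_le_of_le_one_left (sq_nonneg _)
        (pow_le_one₀ (pow_nonneg (by norm_num) _) this)
    linarith
  · -- `R_j → 0`
    have hgeo : Tendsto (fun n : ℕ => (1 / 2 : ℝ) ^ n) atTop (𝓝 0) :=
      tendsto_pow_atTop_nhds_zero_of_lt_one (by norm_num) (by norm_num)
    have h1 : Tendsto (fun j => (1 / 2 : ℝ) ^ (δ j + 2)) atTop (𝓝 0) :=
      hgeo.comp ((tendsto_add_atTop_nat 2).comp hδ.tendsto_atTop)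
    simpa using h1.mul_const ρ₀
  · intro a ha
    obtain ⟨h1, h2, h3, h4⟩ := hlim a ha
    refine ⟨h1, h2, ?_, ?_⟩
    · simpa only [hzoomv] using h3
    · intro g hg
      simpa only [hzoomp] using h4 g hg

end Summit.NavierStokesRegularity.NavierStokesRegularity.Theorems.TraceDensityCriterion

end
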